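import Mathlib
import Literature.AlgebraicGeometry.Resolution.WeightedQuasiRegularGeneral
import Literature.AlgebraicGeometry.Resolution.SymbolicPowersRsop
import Literature.AlgebraicGeometry.Resolution.RsopMonomialIdeals
import HarnessLib

/-!
# Weighted quasi-regularity relative to a regular prime (a weight-`0` direction)

Topic: `Literature/AlgebraicGeometry/Resolution`. The degenerate case of the weighted quasi-
regularity of `WeightedQuasiRegular(General).lean` needed for the graded rings
`gr_{μ₁}(R̂′) ≅ k(x′)[[v′]][U₁′, Z′]` ("`v′` in degree `0`") of the monomial valuations in the
proof of Cossart–Piltant 2008, Lemma 4.5 (pp. 12–14): for a regular local ring `R` of dimension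
`3` with regular system of parameters `(z, u₁, u₂)`, positive integer weights `(w₀, w₁)` on
`(z, u₁)` and weight `0` on `u₂`, the relative weighted ideals
`F_ρ = (zⁱ u₁ᵃ : w₀ i + w₁ a ≥ ρ)` satisfy: a `(w₀, w₁)`-weighted form `F(Y₀, Y₁) ∈ R[Y₀, Y₁]` of
weight `ρ` with `F(z, u₁) ∈ F_{ρ+1}` has all its coefficients in the prime `P = (z, u₁)`
(`coeff_mem_span_of_weval_mem_relative`). Proof: in `S = R[r₀, r₁]/(r₀^{w₀} − z, r₁^{w₁} − u₁)`
(regular, r.s.p. `(r₀, r₁, u₂)`) the stretched form is an honest form in the quasi-regular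
sequence `(r₀, r₁)` (Matsumura 16.2), and `(r₀, r₁)S ∩ R = (z, u₁)` (a prime strictly between
`(z, u₁)` and `𝔪` cannot exist as `dim R/(z, u₁) = 1`).

* `relWeightedIdeal`, `monomial_mem_relWeightedIdeal`;
* `comap_span_roots_eq` — `(r₀, r₁)S ∩ R = (z, u₁)`;
* `coeff_mem_span_of_weval_mem_relative` — the relative weighted quasi-regularity.

## Sources

* V. Cossart, O. Piltant, J. Algebra 320 (2008), proof of Lemma 4.5, pp. 12–14. [CossartPiltant2008]
* H. Matsumura, *Commutative Ring Theory* (1986), Thm. 16.2, Thm. 14.2. [Matsumura1987]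
* H. Hironaka, *Characteristic polyhedra of singularities*, J. Math. Kyoto Univ. 7 (1967). [Hironaka1967]
-/

noncomputable section

open IsLocalRing MvPolynomial

namespace Literature.AlgebraicGeometry.Resolution

universe u

variable {R : Type u} [CommRing R]

/-- **The relative weighted ideal** `F_ρ = (zⁱ u₁ᵃ : w₀ i + w₁ a ≥ ρ)`. [cite: Hironaka1967, §1] -/
def relWeightedIdeal (z u₁ : R) (w₀ w₁ ρ : ℕ) : Ideal R :=
  Ideal.span {m | ∃ i a : ℕ, ρ ≤ w₀ * i + w₁ * a ∧ m = z ^ i * u₁ ^ a}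

/-- Monomials of weight `≥ ρ` lie in `F_ρ`. [folklore] -/
theorem monomial_mem_relWeightedIdeal (z u₁ : R) {w₀ w₁ ρ i a : ℕ} (h : ρ ≤ w₀ * i + w₁ * a) :
    z ^ i * u₁ ^ a ∈ relWeightedIdeal z u₁ w₀ w₁ ρ :=
  Ideal.subset_span ⟨i, a, h, rfl⟩

/-- `eval ![a, b] (monomial m r) = r · a^{m 0} b^{m 1}`. [folklore] -/
theorem eval_monomial_two (x : Fin 2 → R) (m : Fin 2 →₀ ℕ) (r : R) :
    eval x (monomial m r) = r * (x 0 ^ m 0 * x 1 ^ m 1) := by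
  rw [eval_monomial, Finsupp.prod_fintype _ _ (by simp)]
  simp [Fin.prod_univ_two]

section Relative

variable [IsRegularLocalRing R] (z u₁ u₂ : R) (hgen : Ideal.span {z, u₁, u₂} = maximalIdeal R)
  (hd : (maximalIdeal R).spanFinrank = 3) {w₀ w₁ : ℕ} (hw₀ : 0 < w₀) (hw₁ : 0 < w₁)

include hgen hd in
/-- `dim R/(z, u₁) = 1`. [cite: Matsumura1987, Thm. 14.2] -/
theorem ringKrullDim_quotient_span_pair : ringKrullDim (R ⧸ Ideal.span {z, u₁}) = 1 := by
  have hx : Ideal.span (Set.range ![z, u₁, u₂]) = maximalIdeal R := by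
    rw [← hgen]; congr 1; ext a; simp [Matrix.range_cons, Matrix.range_empty]; tauto
  have hpart := isRsopPart_comp_of_rsop hd ![z, u₁, u₂] hx (Fin.castAdd 1 : Fin 2 → Fin 3)
    (Fin.castAdd_injective 2 1)
  have hrange : Set.range (![z, u₁, u₂] ∘ (Fin.castAdd 1 : Fin 2 → Fin 3)) = {z, u₁} := by
    ext a
    simp only [Set.mem_range, Function.comp_apply, Set.mem_insert_iff, Set.mem_singleton_iff]
    constructor
    · rintro ⟨i, rfl⟩; fin_cases i <;> simp
    · rintro (rfl | rfl)
      · exact ⟨0, rfl⟩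
      · exact ⟨1, rfl⟩
  have h := hpart.ringKrullDim_quotient_add
  rw [hrange] at h
  have hR : ringKrullDim R = 3 := by
    have := (isRegularLocalRing_iff R).mp inferInstance
    rw [hd] at this; exact_mod_cast this.symm
  rw [hR] at h
  -- `d + 2 = 3` in `WithBot ℕ∞`
  haveI : Nontrivial (R ⧸ Ideal.span {z, u₁}) := by
    refine Ideal.Quotient.nontrivial_iff.mpr ?_
    refine fun htop => (maximalIdeal.isMaximal R).ne_top ?_
    rw [eq_top_iff, ← htop, ← hgen]
    exact Ideal.span_mono (by intro a ha; simp only [Set.mem_insert_iff, Set.mem_singleton_iff] at ha ⊢; tauto)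
  haveI : IsLocalRing (R ⧸ Ideal.span {z, u₁}) :=
    IsLocalRing.of_surjective' (Ideal.Quotient.mk _) Ideal.Quotient.mk_surjective
  obtain ⟨m, hm⟩ := exists_nat_cast_eq_ringKrullDim (R := R ⧸ Ideal.span {z, u₁})
  rw [hm] at h ⊢
  have : m + 2 = 3 := by exact_mod_cast h
  have hm1 : m = 1 := by omega
  rw [hm1]; rfl

include hgen hd in
/-- `(z, u₁)` is a prime ideal. [cite: Matsumura1987, Thm. 14.2] -/
theorem isPrime_span_pair : (Ideal.span {z, u₁} : Ideal R).IsPrime := by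
  have hx : Ideal.span (Set.range ![z, u₁, u₂]) = maximalIdeal R := by
    rw [← hgen]; congr 1; ext a; simp [Matrix.range_cons, Matrix.range_empty]; tauto
  have h := isPrime_span_image hd ![z, u₁, u₂] hx {0, 1}
  have hset : (![z, u₁, u₂] '' ↑({0, 1} : Finset (Fin 3))) = {z, u₁} := by
    ext a
    simp only [Finset.coe_insert, Finset.coe_singleton, Set.image_insert_eq, Set.image_singleton,
      Matrix.cons_val_zero, Matrix.cons_val_one]
  rwa [hset] at h

include hgen hd hw₀ hw₁ in
/-- **Relative weighted quasi-regularity**: if `F ∈ R[Y₀, Y₁]` has all its monomials of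
`(w₀, w₁)`-weight `ρ` and `F(z, u₁) ∈ F_{ρ+1}`, then all its coefficients lie in `(z, u₁)`.
[cite: CossartPiltant2008, proof of Lemma 4.5, pp. 12–14] [cite: Matsumura1987, Thm. 16.2] -/
theorem coeff_mem_span_of_weval_mem_relative {ρ : ℕ} {F : MvPolynomial (Fin 2) R}
    (hF : ∀ m ∈ F.support, w₀ * m 0 + w₁ * m 1 = ρ)
    (h : eval ![z, u₁] F ∈ relWeightedIdeal z u₁ w₀ w₁ (ρ + 1)) (m : Fin 2 →₀ ℕ) :
    F.coeff m ∈ Ideal.span {z, u₁} := by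
  classical
  by_cases hm : m ∈ F.support
  swap
  · rw [notMem_support_iff.mp hm]; exact Ideal.zero_mem _
  have hR : ringKrullDim R = 3 := by
    have := (isRegularLocalRing_iff R).mp inferInstance
    rw [hd] at this; exact_mod_cast this.symm
  -- two root adjunctions: `S = R[r₀, r₁]/(r₀^{w₀} − z, r₁^{w₁} − u₁)`, r.s.p. `(r₀, r₁, u₂)`
  obtain ⟨B, _, _, ι₁, r₀, hl₁, hi₁, hr₀, hm₁, hd₁⟩ :=
    exists_rootAdjunction_step z u₁ u₂ hgen hR hw₀
  have hm₁' : Ideal.span {ι₁ u₁, ι₁ u₂, r₀} = maximalIdeal B := by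
    rw [← hm₁]; congr 1; ext x; simp only [Set.mem_insert_iff, Set.mem_singleton_iff]; tauto
  obtain ⟨S, _, _, ι₂, r₁, hl₂, hi₂, hr₁, hm₂, hd₂⟩ :=
    exists_rootAdjunction_step (ι₁ u₁) (ι₁ u₂) r₀ hm₁' hd₁ hw₁
  haveI := hl₁; haveI := hl₂
  set ι : R →+* S := ι₂.comp ι₁ with hιdef
  haveI : IsLocalHom ι := RingHom.isLocalHom_comp _ _
  set s₀ : S := ι₂ r₀
  have hs₀ : s₀ ^ w₀ = ι z := by rw [← map_pow, hr₀]; rfl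
  have hs₁ : r₁ ^ w₁ = ι u₁ := hr₁
  have hgenS : Ideal.span {s₀, r₁, ι u₂} = maximalIdeal S := by
    rw [← hm₂]; congr 1; ext x; simp only [Set.mem_insert_iff, Set.mem_singleton_iff]; tauto
  set x : Fin 3 → S := ![s₀, r₁, ι u₂] with hxdef
  have hrange3 : Set.range x = {s₀, r₁, ι u₂} := by
    ext t
    simp only [Set.mem_range, Set.mem_insert_iff, Set.mem_singleton_iff, hxdef]
    constructor
    · rintro ⟨i, rfl⟩; fin_cases i <;> simp
    · rintro (rfl | rfl | rfl)
      exacts [⟨0, rfl⟩, ⟨1, rfl⟩, ⟨2, rfl⟩]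
  have hxS : Ideal.span (Set.range x) = maximalIdeal S := by rw [hrange3, hgenS]
  have hfr : (maximalIdeal S).spanFinrank = 3 := by
    have := (isRegularLocalRing_iff S).mp inferInstance
    rw [hd₂] at this; exact_mod_cast this
  -- quasi-regularity of the part `(s₀, r₁)`
  have hQR := isQuasiRegular_rsop_comp hfr x hxS (Fin.castAdd 1 : Fin 2 → Fin 3)
    (Fin.castAdd_injective 2 1)
  have hxe : x ∘ (Fin.castAdd 1 : Fin 2 → Fin 3) = ![s₀, r₁] := by
    funext i; fin_cases i <;> rfl
  rw [hxe] at hQR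
  have hrangeI : Set.range ![s₀, r₁] = {s₀, r₁} := by
    ext a; simp [Matrix.range_cons, Matrix.range_empty]; tauto
  -- the stretched form `G`
  let st : (Fin 2 →₀ ℕ) → (Fin 2 →₀ ℕ) := fun n =>
    Finsupp.equivFunOnFinite.symm ![w₀ * n 0, w₁ * n 1]
  have hst0 : ∀ n, st n 0 = w₀ * n 0 := fun n => rfl
  have hst1 : ∀ n, st n 1 = w₁ * n 1 := fun n => rfl
  have hst_inj : Function.Injective st := by
    intro n n' hnn
    ext i
    fin_cases i
    · have := congrArg (fun e : Fin 2 →₀ ℕ => e 0) hnn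
      simp only [hst0] at this
      exact Nat.eq_of_mul_eq_mul_left hw₀ this
    · have := congrArg (fun e : Fin 2 →₀ ℕ => e 1) hnn
      simp only [hst1] at this
      exact Nat.eq_of_mul_eq_mul_left hw₁ this
  set G : MvPolynomial (Fin 2) S := ∑ n ∈ F.support, monomial (st n) (ι (F.coeff n)) with hG
  have hGcoeff : ∀ n ∈ F.support, G.coeff (st n) = ι (F.coeff n) := by
    intro n hn
    rw [hG, coeff_sum, Finset.sum_eq_single n]
    · rw [coeff_monomial, if_pos rfl]
    · intro n' _ hne
      rw [coeff_monomial, if_neg]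
      exact fun h' => hne (hst_inj h')
    · intro hn'; exact absurd hn hn'
  have hGhom : G.IsHomogeneous ρ := by
    rw [hG]
    refine IsHomogeneous.sum _ _ _ fun n hn => isHomogeneous_monomial _ ?_
    rw [Finsupp.degree_eq_weight_one]
    change Finsupp.weight (fun _ => 1) (st n) = ρ
    rw [Finsupp.weight_apply, Finsupp.sum_fintype _ _ (by simp)]
    simp [Fin.sum_univ_two, hst0, hst1, hF n hn]
  have hpow0 : ∀ k : ℕ, s₀ ^ (w₀ * k) = ι (z ^ k) := fun k => by rw [pow_mul, hs₀, map_pow]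
  have hpow1 : ∀ k : ℕ, r₁ ^ (w₁ * k) = ι (u₁ ^ k) := fun k => by rw [pow_mul, hs₁, map_pow]
  have hGeval : eval ![s₀, r₁] G = ι (eval ![z, u₁] F) := by
    conv_rhs => rw [F.as_sum, map_sum, map_sum]
    rw [hG, map_sum]
    refine Finset.sum_congr rfl fun n _ => ?_
    rw [eval_monomial_two, eval_monomial_two, map_mul]
    congr 1
    simp only [Matrix.cons_val_zero, Matrix.cons_val_one, hst0, hst1, hpow0,
      hpow1, ← map_mul]
  -- `ι(F_{ρ+1}) ⊆ (s₀, r₁)^{ρ+1}`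
  set I : Ideal S := Ideal.span {s₀, r₁} with hIdef
  have hmemI : ∀ k l : ℕ, s₀ ^ k * r₁ ^ l ∈ I ^ (k + l) := by
    intro k l
    rw [pow_add]
    exact Ideal.mul_mem_mul (Ideal.pow_mem_pow (Ideal.subset_span (by simp)) k)
      (Ideal.pow_mem_pow (Ideal.subset_span (by simp)) l)
  have hFle : (relWeightedIdeal z u₁ w₀ w₁ (ρ + 1)).map ι ≤ I ^ (ρ + 1) := by
    rw [relWeightedIdeal, Ideal.map_span]
    refine Ideal.span_le.mpr ?_
    rintro _ ⟨_, ⟨i, a, hia, rfl⟩, rfl⟩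
    rw [SetLike.mem_coe, map_mul, ← hpow0, ← hpow1]
    exact Ideal.pow_le_pow_right hia (hmemI _ _)
  have hGmem : eval ![s₀, r₁] G ∈ Ideal.span (Set.range ![s₀, r₁]) ^ (ρ + 1) := by
    rw [hrangeI, hGeval]; exact hFle (Ideal.mem_map_of_mem _ h)
  -- Matsumura 16.2: the coefficients of `G` lie in `(s₀, r₁)`
  have hc := (isQuasiRegular_def _).mp hQR ρ G hGhom hGmem (st m)
  rw [hGcoeff m hm, hrangeI] at hc
  -- `(s₀, r₁)S ∩ R = (z, u₁)`
  change F.coeff m ∈ Ideal.span {z, u₁}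
  have hKle : I.comap ι ≤ Ideal.span {z, u₁} := by
    -- the prime `K = ι⁻¹(s₀, r₁) ⊇ (z, u₁)` is not `𝔪` (as `u₂ ∉ K`) and `dim R/(z,u₁) = 1`
    haveI hIprime : I.IsPrime := by
      have h := isPrime_span_image hfr x hxS {0, 1}
      have hset : (x '' ↑({0, 1} : Finset (Fin 3))) = {s₀, r₁} := by
        ext a
        simp only [hxdef, Finset.coe_insert, Finset.coe_singleton, Set.image_insert_eq,
          Set.image_singleton, Matrix.cons_val_zero, Matrix.cons_val_one]
      rwa [hset] at h
    haveI hP : (Ideal.span {z, u₁} : Ideal R).IsPrime := isPrime_span_pair z u₁ u₂ hgen hd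
    have hPK : Ideal.span {z, u₁} ≤ I.comap ι := by
      rw [Ideal.span_le]
      intro a ha
      simp only [Set.mem_insert_iff, Set.mem_singleton_iff] at ha
      rw [SetLike.mem_coe, Ideal.mem_comap]
      rcases ha with rfl | rfl
      · rw [← hs₀]; exact Ideal.pow_mem_of_mem _ (Ideal.subset_span (by simp)) _ hw₀
      · rw [← hs₁]; exact Ideal.pow_mem_of_mem _ (Ideal.subset_span (by simp)) _ hw₁
    have hu₂K : u₂ ∉ I.comap ι := by
      intro hu
      rw [Ideal.mem_comap] at hu
      have hle2 : maximalIdeal S ≤ I := by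
        rw [← hgenS, Ideal.span_le]
        intro a ha
        simp only [Set.mem_insert_iff, Set.mem_singleton_iff] at ha
        rcases ha with rfl | rfl | rfl
        · exact Ideal.subset_span (by simp)
        · exact Ideal.subset_span (by simp)
        · exact hu
      have h1 := Submodule.spanFinrank_span_le_ncard_of_finite (R := S)
        (Set.toFinite ({s₀, r₁} : Set S))
      have h2 : ({s₀, r₁} : Set S).ncard ≤ 2 := by
        rw [← Finset.coe_pair, Set.ncard_coe_finset]; exact Finset.card_le_two
      have h3 : I = maximalIdeal S := le_antisymm
        (hIprime.ne_top.lt_top.le.trans' le_rfl |> fun _ => le_maximalIdeal hIprime.ne_top) hle2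
      have h4 : (maximalIdeal S).spanFinrank ≤ 2 := by rw [← h3]; exact h1.trans h2
      omega
    -- in the one-dimensional local domain `R/(z,u₁)` the prime `K/(z,u₁)` is `⊥` or maximal
    by_contra hK
    have hne : (I.comap ι).map (Ideal.Quotient.mk (Ideal.span {z, u₁})) ≠ ⊥ := by
      intro hbot
      rw [Ideal.map_eq_bot_iff_le_ker, Ideal.mk_ker] at hbot
      exact hK hbot
    haveI : IsDomain (R ⧸ Ideal.span {z, u₁}) := Ideal.Quotient.isDomain _
    haveI : Ring.KrullDimLE 1 (R ⧸ Ideal.span {z, u₁}) :=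
      Ring.krullDimLE_iff.mpr (ringKrullDim_quotient_span_pair z u₁ u₂ hgen hd).le
    have hprime : ((I.comap ι).map (Ideal.Quotient.mk (Ideal.span {z, u₁}))).IsPrime :=
      Ideal.map_isPrime_of_surjective Ideal.Quotient.mk_surjective (by rw [Ideal.mk_ker]; exact hPK)
    have hmax := (Ring.krullDimLE_one_iff_of_noZeroDivisors.mp inferInstance) _ hne hprime
    -- hence `K ⊇ 𝔪`, so `u₂ ∈ K`: contradiction
    have hKmax : (I.comap ι).IsMaximal := by
      have := Ideal.comap_isMaximal_of_surjective (Ideal.Quotient.mk (Ideal.span {z, u₁}))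
        Ideal.Quotient.mk_surjective (K := (I.comap ι).map (Ideal.Quotient.mk (Ideal.span {z, u₁})))
      rw [Ideal.comap_map_of_surjective _ Ideal.Quotient.mk_surjective, ← RingHom.ker_eq_comap_bot,
        Ideal.mk_ker, sup_eq_left.mpr hPK] at this
      exact this
    have hKeq : I.comap ι = maximalIdeal R := IsLocalRing.eq_maximalIdeal hKmax
    exact hu₂K (hKeq ▸ (hgen ▸ Ideal.subset_span (by simp)))
  exact hKle (Ideal.mem_comap.mpr hc)

end Relative

end Literature.AlgebraicGeometry.Resolution

end
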